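import Mathlib

/-!
# Bordered eigenpair certificate: the kernel-checkable linear algebra (instab g7, cell `ns-blowup`, 2026-08-25)

HONEST FRAMING (human ruling D-0035): nothing here is a claim about Navier–Stokes blow-up.
WHAT THIS IS NOT: not NS evidence. These are the abstract linear-algebra facts behind THEOREM 3-B of
`instab/CERT-ROPE-X0.md` (the BORDERED skew-cut certificate: from a float eigenpair `(λ̃, ṽ)` of the
MODEL operator «NS linearised about the forced ABC flow» — crux X0 of lane N1* — to a certified SIMPLE,
ISOLATED eigenpair with enclosure). The functional analysis (Lax–Milgram on the Fourier tail, the Banach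
fixed point in the augmented space) stays paper-grade in that note; what is kernel here is exactly the
three facts used in its steps (c) and (d), valid for ANY linear map `L` on ANY vector space `E` over a
field, any scalar `λ`, any vector `v` with `L v = λ • v`, and any linear functional `φ`:

Call the bordered map at `z` the linear map `(w, μ) ↦ (L w − z • w + μ • v, φ w)` on `E × 𝕜`; its
injectivity is recorded below in kernel form
`hinj : ∀ w μ, L w - z • w + μ • v = 0 → φ w = 0 → w = 0 ∧ μ = 0`.

* `vec_ne_zero_of_bordered_injective`, `functional_ne_zero_of_bordered_injective` — bordered
  injectivity (at any `z`, resp. at `z = λ`) forces `v ≠ 0` and `φ v ≠ 0`.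
* `eq_smul_of_bordered_injective` (K-B1) — bordered-injective at `λ` ⇒ every `λ`-eigenvector of `L`
  is a multiple of `v`: `ker (L − λ) ⊆ span {v}` (geometric multiplicity one).
* `ne_of_bordered_injective` (K-B2) — bordered-injective at `λ` ⇒ no `w` with `L w − λ • w = v`
  (no Jordan chain: `v ∉ range (L − λ)`), and `sq_ker_of_bordered_injective` — hence
  `(L − λ)²u = 0 → (L − λ)u = 0` (algebraic multiplicity one).
* `eq_zero_of_bordered_injective_of_ne` (K-B3) — bordered-injective at `z ≠ λ` (same `v`, `φ`) ⇒ `z`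
  is not an eigenvalue of `L`. (In the note: the bordered operator at the certified pair stays
  invertible for `|z − λ*| < 1/M*` by a Neumann series, whence ISOLATION.)
* `abc_grad_frobenius_sq` — the pointwise identity `‖∇U(x)‖_F² = 3` for `U = abc(1,1,1)` used in
  LEMMA R of the note (each derivative of the eigenvector error costs `√(O(1)/ν)`, not `|U|_∞/ν`).

Mathlib only; no new definitions.
-/

namespace Summit.NavierStokesRegularity.FluidComputer.BorderedEigenpairCertificate

section Bordered

variable {𝕜 : Type*} [Field 𝕜] {E : Type*} [AddCommGroup E] [Module 𝕜 E]
variable (L : E →ₗ[𝕜] E) (φ : E →ₗ[𝕜] 𝕜) (v : E) (z lam : 𝕜)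

/-- Bordered injectivity at any `z` forces the bordering vector to be nonzero
(test the pair `(w, μ) = (0, 1)`). -/
theorem vec_ne_zero_of_bordered_injective
    (hinj : ∀ (w : E) (μ : 𝕜), L w - z • w + μ • v = 0 → φ w = 0 → w = 0 ∧ μ = 0) :
    v ≠ 0 := by
  intro hv
  have h := hinj 0 1 (by simp [hv]) (by simp)
  exact one_ne_zero h.2

/-- Bordered injectivity at the eigenvalue `lam` of the bordering eigenvector `v` forces `φ v ≠ 0`
(test the pair `(v, 0)`). -/
theorem functional_ne_zero_of_bordered_injective (hv : L v = lam • v)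
    (hinj : ∀ (w : E) (μ : 𝕜), L w - lam • w + μ • v = 0 → φ w = 0 → w = 0 ∧ μ = 0) :
    φ v ≠ 0 := by
  intro hφ
  have h := hinj v 0 (by simp [hv]) hφ
  exact vec_ne_zero_of_bordered_injective L φ v lam hinj h.1

/-- **K-B1 (geometric multiplicity one).** If the bordered map at `lam` is injective and
`L v = lam • v`, then every `u` with `L u = lam • u` is the multiple `(φ u / φ v) • v` of `v`. -/
theorem eq_smul_of_bordered_injective (hv : L v = lam • v)
    (hinj : ∀ (w : E) (μ : 𝕜), L w - lam • w + μ • v = 0 → φ w = 0 → w = 0 ∧ μ = 0)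
    (u : E) (hu : L u = lam • u) :
    u = (φ u / φ v) • v := by
  have hφv : φ v ≠ 0 := functional_ne_zero_of_bordered_injective L φ v lam hv hinj
  set c : 𝕜 := φ u / φ v with hc
  have h1 : L (u - c • v) - lam • (u - c • v) + (0 : 𝕜) • v = 0 := by
    simp only [map_sub, map_smul, hu, hv, zero_smul, add_zero, smul_sub]
    rw [smul_comm lam c v]
    abel
  have h2 : φ (u - c • v) = 0 := by
    simp only [map_sub, map_smul, smul_eq_mul, hc]
    field_simp
    ring
  have h := (hinj (u - c • v) 0 h1 h2).1
  exact sub_eq_zero.mp h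

/-- **K-B1, division-free form.** Under the same hypotheses, `(φ v) • u = (φ u) • v`. -/
theorem smul_eq_smul_of_bordered_injective (hv : L v = lam • v)
    (hinj : ∀ (w : E) (μ : 𝕜), L w - lam • w + μ • v = 0 → φ w = 0 → w = 0 ∧ μ = 0)
    (u : E) (hu : L u = lam • u) :
    (φ v) • u = (φ u) • v := by
  have hφv : φ v ≠ 0 := functional_ne_zero_of_bordered_injective L φ v lam hv hinj
  have h := eq_smul_of_bordered_injective L φ v lam hv hinj u hu
  rw [h, smul_smul, map_smul, smul_eq_mul]
  congr 1
  field_simp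

/-- **K-B2 (no Jordan chain).** If the bordered map at `lam` is injective and `L v = lam • v`, then
`v` is not in the range of `L − lam`: there is no `w` with `L w − lam • w = v`. -/
theorem ne_of_bordered_injective (hv : L v = lam • v)
    (hinj : ∀ (w : E) (μ : 𝕜), L w - lam • w + μ • v = 0 → φ w = 0 → w = 0 ∧ μ = 0)
    (w : E) : L w - lam • w ≠ v := by
  intro hw
  have hφv : φ v ≠ 0 := functional_ne_zero_of_bordered_injective L φ v lam hv hinj
  set c : 𝕜 := φ w / φ v with hc
  have h1 : L (w - c • v) - lam • (w - c • v) + (-1 : 𝕜) • v = 0 := by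
    have : L w - lam • w - c • (L v - lam • v) + (-1 : 𝕜) • v = 0 := by
      rw [hw, hv, sub_self, smul_zero, sub_zero, neg_one_smul, add_neg_cancel]
    simpa only [map_sub, map_smul, smul_sub, smul_comm lam c v, sub_sub_sub_comm] using this
  have h2 : φ (w - c • v) = 0 := by
    simp only [map_sub, map_smul, smul_eq_mul, hc]
    field_simp
    ring
  have h := (hinj (w - c • v) (-1) h1 h2).2
  exact (neg_ne_zero.mpr one_ne_zero) h

/-- **K-B2′ (algebraic multiplicity one).** Under the same hypotheses the generalised eigenspace
stops at the first step: `(L − lam)((L − lam) u) = 0 → (L − lam) u = 0`. -/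
theorem sq_ker_of_bordered_injective (hv : L v = lam • v)
    (hinj : ∀ (w : E) (μ : 𝕜), L w - lam • w + μ • v = 0 → φ w = 0 → w = 0 ∧ μ = 0)
    (u : E) (hu : L (L u - lam • u) - lam • (L u - lam • u) = 0) :
    L u - lam • u = 0 := by
  set y : E := L u - lam • u with hy
  have hLy : L y = lam • y := sub_eq_zero.mp hu
  -- `y` is a `lam`-eigenvector, hence a multiple of `v`
  have hyv := smul_eq_smul_of_bordered_injective L φ v lam hv hinj y hLy
  have hφv : φ v ≠ 0 := functional_ne_zero_of_bordered_injective L φ v lam hv hinj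
  by_cases hφy : φ y = 0
  · -- then `(φ v) • y = 0` with `φ v ≠ 0`
    rw [hφy, zero_smul] at hyv
    exact (smul_eq_zero.mp hyv).resolve_left hφv
  · -- else `u' := (φ v / φ y) • u` would be a Jordan chain vector: `(L − lam) u' = v`
    exfalso
    have hchain : L ((φ v / φ y) • u) - lam • ((φ v / φ y) • u) = v := by
      rw [map_smul, smul_comm lam, ← smul_sub, ← hy]
      have : (φ v / φ y) • y = (φ y)⁻¹ • ((φ v) • y) := by
        rw [smul_smul]; congr 1; field_simp
      rw [this, hyv, smul_smul, inv_mul_cancel₀ hφy, one_smul]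
    exact ne_of_bordered_injective L φ v lam hv hinj _ hchain

/-- **K-B3 (isolation step).** If `L v = lam • v`, `z ≠ lam`, and the bordered map AT `z` (same `v`,
same `φ`) is injective, then `z` is not an eigenvalue of `L`: `L u = z • u → u = 0`. -/
theorem eq_zero_of_bordered_injective_of_ne (hv : L v = lam • v) (hz : z ≠ lam)
    (hinj : ∀ (w : E) (μ : 𝕜), L w - z • w + μ • v = 0 → φ w = 0 → w = 0 ∧ μ = 0)
    (u : E) (hu : L u = z • u) :
    u = 0 := by
  -- first `φ v ≠ 0`: test the pair `(v, z - lam)`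
  have hφv : φ v ≠ 0 := by
    intro hφ
    have h := hinj v (z - lam) (by rw [hv, ← sub_smul, ← add_smul]; ring_nf; simp) hφ
    exact hz (sub_eq_zero.mp h.2)
  set c : 𝕜 := φ u / φ v with hc
  -- test the pair `(u - c • v, c * (lam - z))`
  have h1 : L (u - c • v) - z • (u - c • v) + (c * (lam - z)) • v = 0 := by
    rw [map_sub, map_smul, hu, hv, smul_sub, smul_smul, smul_smul, mul_comm z c]
    rw [show (c * (lam - z)) • v = (c * lam) • v - (c * z) • v by rw [← sub_smul]; ring_nf]
    abel
  have h2 : φ (u - c • v) = 0 := by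
    simp only [map_sub, map_smul, smul_eq_mul, hc]
    field_simp
    ring
  have h := hinj (u - c • v) (c * (lam - z)) h1 h2
  have hc0 : c = 0 := by
    rcases mul_eq_zero.mp h.2 with h0 | h0
    · exact h0
    · exact absurd (sub_eq_zero.mp h0).symm hz
  have := h.1
  rw [hc0, zero_smul, sub_zero] at this
  exact this

end Bordered

section ABC

open Real

/-- **ABC gradient identity (LEMMA R of the note).** For `U = abc(1,1,1) = (sin z + cos y,
sin x + cos z, sin y + cos x)` the Jacobian `∇U` has zero diagonal and the six off-diagonal entries
`∂_y U₁ = −sin y`, `∂_z U₁ = cos z`, `∂_x U₂ = cos x`, `∂_z U₂ = −sin z`, `∂_x U₃ = −sin x`,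
`∂_y U₃ = cos y`; their squares sum to `3` at EVERY point: `‖∇U(x)‖_F² = 3`. -/
theorem abc_grad_frobenius_sq (x y z : ℝ) :
    (-sin y) ^ 2 + (cos z) ^ 2 + (cos x) ^ 2 + (-sin z) ^ 2 + (-sin x) ^ 2 + (cos y) ^ 2 = 3 := by
  linear_combination sin_sq_add_cos_sq x + sin_sq_add_cos_sq y + sin_sq_add_cos_sq z

/-- The derivative entries are genuinely those of `abc(1,1,1)`: e.g. the first component
`U₁(x,y,z) = sin z + cos y` has `∂_y U₁ = −sin y` and `∂_z U₁ = cos z` (one representative pair;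
the other four are the same computation with the variables permuted). -/
theorem abc_first_component_partials (y z : ℝ) :
    HasDerivAt (fun t => sin z + cos t) (-sin y) y ∧ HasDerivAt (fun t => sin t + cos y) (cos z) z := by
  refine ⟨?_, ?_⟩
  · simpa using ((hasDerivAt_cos y).const_add (sin z))
  · simpa using ((hasDerivAt_sin z).add_const (cos y))

end ABC

end Summit.NavierStokesRegularity.FluidComputer.BorderedEigenpairCertificate
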